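import Literature.Geometry.Lorentzian.GreenIdentityCompactSupport
import Literature.Geometry.Lorentzian.DalembertianCompose
import Literature.Geometry.Lorentzian.EnergyCurrents
import Mathlib.Analysis.Calculus.ParametricIntegral
import Mathlib.Analysis.SpecialFunctions.SmoothTransition
import Mathlib.Analysis.SpecialFunctions.Pow.Deriv
import Mathlib.Analysis.Calculus.Deriv.MeanValue
import HarnessLib

/-!
# The monotonicity formula, intrinsic (Laplacian-comparison) form

Let `(N, h)` be a Riemannian manifold without boundary (Hausdorff, locally compact, σ-compact;
NOT necessarily compact or complete) and `u ∈ C^∞(N)`, `u ≥ 0`, with compact sublevel sets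
`{u ≤ t}` for `t < S` and

  `Δ_h u ≥ c₁`   and   `|∇u|²_h ≤ c₂ u`   on `{u < S}`,   `c₂ > 0`.

We PROVE that the volume ratio

  `s ↦ μ_h {u < s} / s^{c₁/c₂}`   is nondecreasing on `(0, S)`

(`measureReal_setOf_lt_div_rpow_mono`), through its smoothed form
`s ↦ s^{−c₁/c₂} ∫ ψ(u/s) dμ ↑` for every nonnegative antitone `ψ ∈ C¹` vanishing on `[1, ∞)`
(`monotoneOn_rpow_mul_integral_comp_div`), which rests on the one-line integral inequality

  `c₁ ∫ ψ(u/s) dμ ≤ c₂ ∫ (−ψ'(u/s)) (u/s) dμ`        (`mul_integral_comp_le_of_dalembertian_ge`)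

— Green's identity for the compactly supported test function `ψ(u/s)`
(`GreenIdentityCompactSupport.lean`): `∫ ψ(u/s) Δu = (1/s) ∫ (−ψ'(u/s)) |∇u|²`, with `Δu ≥ c₁` on
the left and `|∇u|² ≤ c₂ u` on the right — and on `s I'(s) = ∫ (−ψ'(u/s))(u/s) dμ`
(`hasDerivAt_integral_comp_div`, differentiation under the integral sign).

This is the monotonicity formula of minimal-surface theory with the geometry separated from the
calculus: for a `k`-dimensional minimal submanifold `Σ ⊂ ℝⁿ` without boundary in `B_R(x₀)` and
`u = |x − x₀|²/2|_Σ` one has `Δ_Σ u = k` (the coordinate functions are harmonic, `Δ_Σ x = H = 0`)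
and `|∇_Σ u|² = |x^T|² ≤ |x|² = 2u`, so `c₁/c₂ = k/2` and, with `s = r²/2`, the statement is the
monotonicity of `Vol(Σ ∩ B_r(x₀))/r^k` (Morgan 2016, Thm. 9.3 — there for area-minimising
currents, by cone comparison — with the Remark "Monotonicity for minimal surfaces … holds for
stationary (minimal) surfaces [Allard, 5.1]" and Cor. 9.5, `Area(T ∩ B(a,r)) ≥ πr²`; Simon 1983,
§17). The hypotheses are stable under perturbation — `Hess φ ≥ (1 − ε) g` and
`|∇φ|² ≤ 2(1 + ε) φ` for the ambient function `φ` give `Δ_Σ(φ|_Σ) ≥ k(1 − ε)` on a minimal `Σ` and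
the exponent `k(1−ε)/(2(1+ε))` — which is the form needed far out on an asymptotically flat end,
where `|y|²` is uniformly convex (Schoen–Yau 1979, §2, (2.4)), and in the area bound (2.23),
`A(Σ ∩ B_r(x₀)) ≥ πr²`, of the first proof of their Claim (p. 56, citing Alexander–Osserman).
The passage from an immersed minimal hypersurface to the hypotheses on `u = φ ∘ f` is
`PseudoRiemannianMetric.dalembertian_comp_eq` (`HypersurfaceHessian.lean`: `Δ(φ ∘ f) = tr Hess φ|_{TΣ}`
for `H = 0`) and `gradSq_comp_le_of_isSpacelikeImmersion` (`SchoenYauStableSurface.lean`).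

Everything is proved; no definitions, no named facts.

## References

* F. Morgan, *Geometric Measure Theory. A Beginner's Guide*, 5th ed., Academic Press 2016, §9.2,
  Thm. 9.3 (monotonicity of the mass ratio, = Federer 1969, 5.4.3), the Remark following it, and
  Cor. 9.5 (read in the held copy). [Morgan2016]
* W. K. Allard, *On the first variation of a varifold*, Ann. of Math. 95 (1972) 417–491, §5.1
  (monotonicity for stationary varifolds). [Allard1972]
* L. Simon, *Lectures on Geometric Measure Theory*, Proc. CMA 3, ANU 1983, §17 (the monotonicity
  formula). [Simon1983]
* R. Schoen, S.-T. Yau, *On the proof of the positive mass conjecture in general relativity*,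
  Comm. Math. Phys. 65 (1979) 45–76, §2 (2.4) and p. 56, (2.23). [SchoenYauPMT1979]
-/

noncomputable section

open Bundle Set Function Filter Module TopologicalSpace MeasureTheory Metric
open scoped Manifold ContDiff Topology

namespace Literature.Geometry.Riemannian

open Literature.Geometry.Lorentzian Literature.Geometry.Lorentzian.PseudoRiemannianMetric

/-! ### Real-variable preliminaries -/

section Real

/-- A nonnegative function vanishing on `[1, ∞)` has zero derivative there (every such point is
a minimum). [folklore] -/
theorem deriv_eq_zero_of_nonneg_of_eq_zero {ψ : ℝ → ℝ} (hψ0 : ∀ t, 0 ≤ ψ t)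
    (hψ1 : ∀ t, 1 ≤ t → ψ t = 0) {t : ℝ} (ht : 1 ≤ t) : deriv ψ t = 0 := by
  have hmin : IsLocalMin ψ t := Filter.Eventually.of_forall fun s ↦ by
    rw [hψ1 t ht]; exact hψ0 s
  exact hmin.deriv_eq_zero

/-- The derivative of an antitone `C¹` function vanishing on `[1, ∞)` is bounded on `[0, ∞)`:
`|ψ'| ≤ B` there. [folklore] -/
theorem exists_bound_deriv_of_contDiff {ψ : ℝ → ℝ} (hψ : ContDiff ℝ 1 ψ) (hψ0 : ∀ t, 0 ≤ ψ t)
    (hψ1 : ∀ t, 1 ≤ t → ψ t = 0) : ∃ B : ℝ, 0 ≤ B ∧ ∀ t, 0 ≤ t → |deriv ψ t| ≤ B := by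
  have hc : Continuous (deriv ψ) := hψ.continuous_deriv le_rfl
  obtain ⟨B, hB⟩ := isCompact_Icc.exists_bound_of_continuousOn (hc.continuousOn (s := Icc (0:ℝ) 1))
  refine ⟨max B 0, le_max_right _ _, fun t ht ↦ ?_⟩
  by_cases h1 : t ≤ 1
  · exact ((Real.norm_eq_abs _).symm.le.trans (hB t ⟨ht, h1⟩)).trans (le_max_left _ _)
  · rw [deriv_eq_zero_of_nonneg_of_eq_zero hψ0 hψ1 (le_of_not_ge h1), abs_zero]
    exact le_max_right _ _

/-- `d/dx ψ(c/x) = ψ'(c/x) · (−c/x²)`. [folklore] -/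
theorem hasDerivAt_comp_const_div {ψ : ℝ → ℝ} (hψ : Differentiable ℝ ψ) (c : ℝ) {x : ℝ}
    (hx : x ≠ 0) :
    HasDerivAt (fun y ↦ ψ (c / y)) (deriv ψ (c / x) * (c * (-(x ^ 2)⁻¹))) x := by
  have h1 : HasDerivAt (fun y : ℝ ↦ c / y) (c * (-(x ^ 2)⁻¹)) x := by
    simpa [div_eq_mul_inv] using (hasDerivAt_inv hx).const_mul c
  exact (hψ (c / x)).hasDerivAt.comp x h1

/-- `d/dt ψ(t/s) = ψ'(t/s)/s`. [folklore] -/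
theorem deriv_comp_div_const {ψ : ℝ → ℝ} (hψ : Differentiable ℝ ψ) (s t : ℝ) :
    deriv (fun r ↦ ψ (r / s)) t = deriv ψ (t / s) / s := by
  have h1 : HasDerivAt (fun r : ℝ ↦ r / s) (1 / s) t := by
    simpa using (hasDerivAt_id t).div_const s
  have h2 : HasDerivAt (fun r ↦ ψ (r / s)) (deriv ψ (t / s) * (1 / s)) t :=
    (hψ (t / s)).hasDerivAt.comp t h1
  rw [h2.deriv]
  ring

end Real

/-! ### The integral inequality and the monotonicity of the smoothed ratio -/

section Core

variable {m : ℕ} {H : Type*} [TopologicalSpace H]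
  {I : ModelWithCorners ℝ (EuclideanSpace ℝ (Fin m)) H} [I.Boundaryless]
  {N : Type*} [TopologicalSpace N] [ChartedSpace H N] [IsManifold I ∞ N]
  [T2Space N] [LocallyCompactSpace N] [SigmaCompactSpace N] [MeasurableSpace N] [BorelSpace N]
  (h : ContMDiffRiemannianMetric I ∞ (EuclideanSpace ℝ (Fin m)) (TangentSpace I : N → Type _))
  [(ofRiemannian h).HasLeviCivita]

/-- **The basic integral inequality.** Let `u ∈ C^∞(N)` with compact sublevel set `{u ≤ s}`
(`s > 0`), `Δu ≥ c₁` and `|∇u|² ≤ c₂ u` on `{u < s}`, and let `ψ ∈ C¹(ℝ)` be nonnegative,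
antitone and `= 0` on `[1, ∞)`. Then

  `c₁ ∫ ψ(u/s) dμ ≤ c₂ ∫ (−ψ'(u/s)) (u/s) dμ`.

Proof: Green's identity for the compactly supported `ψ(u/s)`
(`integral_mul_dalembertian_eq_neg_integral_innerDual_of_hasCompactSupport`):
`∫ ψ(u/s) Δu = −∫ ⟨d(ψ(u/s)), du⟩ = (1/s) ∫ (−ψ'(u/s)) |∇u|²`, then `Δu ≥ c₁` on the left and
`|∇u|² ≤ c₂ u` on the right. For a minimal `k`-submanifold of `ℝⁿ` and `u = |x|²/2`
(`Δu = k`, `|∇u|² ≤ 2u`) this is the identity behind the monotonicity of `Vol(B_r ∩ Σ)/r^k`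
(Simon 1983, §17; Morgan 2016, Thm. 9.3 and the Remark after it). [cite: Morgan2016, Thm. 9.3 and Remark] -/
theorem mul_integral_comp_le_of_dalembertian_ge {u : N → ℝ} (hu : CMDiff ∞ u)
    {s : ℝ} (hs : 0 < s) (hcpt : IsCompact {y | u y ≤ s}) {c₁ c₂ : ℝ}
    (hΔ : ∀ y, u y < s → c₁ ≤ (ofRiemannian h).dalembertian u y)
    (hgrad : ∀ y, u y < s → (ofRiemannian h).gradSq u y ≤ c₂ * u y)
    {ψ : ℝ → ℝ} (hψ : ContDiff ℝ 1 ψ) (hψ0 : ∀ t, 0 ≤ ψ t) (hψa : Antitone ψ)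
    (hψ1 : ∀ t, 1 ≤ t → ψ t = 0) :
    c₁ * ∫ y, ψ (u y / s) ∂riemannianMeasure h ≤
      c₂ * ∫ y, (-deriv ψ (u y / s)) * (u y / s) ∂riemannianMeasure h := by
  set g := ofRiemannian h with hg
  set μ := riemannianMeasure h with hμ
  set ζ : ℝ → ℝ := fun r ↦ ψ (r / s) with hζ
  set w : N → ℝ := fun y ↦ ψ (u y / s) with hw
  have hψd : Differentiable ℝ ψ := hψ.differentiable one_ne_zero
  have huc : Continuous u := hu.continuous
  have hu2 : CMDiff 2 u := hu.of_le (by norm_cast)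
  have hu1 : CMDiff 1 u := hu.of_le (by norm_cast)
  -- the test function `w = ψ(u/s)` is `C¹` with compact support in `{u ≤ s}`
  have hζs : ContDiff ℝ 1 ζ := hψ.comp (contDiff_id.div_const s)
  have hw1 : CMDiff 1 w := hζs.comp_contMDiff hu1
  have hw0 : ∀ y, s ≤ u y → w y = 0 := fun y hy ↦
    hψ1 _ ((one_le_div hs).2 hy)
  have hwsupp : support w ⊆ {y | u y < s} := by
    intro y hy
    rw [mem_support] at hy
    by_contra h'
    simp only [mem_setOf_eq, not_lt] at h'
    exact hy (hw0 y h')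
  have hwc : HasCompactSupport w := by
    refine hcpt.of_isClosed_subset (isClosed_tsupport _) ?_
    exact closure_minimal (hwsupp.trans fun y (hy : u y < s) ↦ show u y ≤ s from hy.le)
      (isClosed_le huc continuous_const)
  -- derivative of `ψ` vanishes on `[1, ∞)`, is `≤ 0` everywhere
  have hψ'0 : ∀ y, s ≤ u y → deriv ψ (u y / s) = 0 := fun y hy ↦
    deriv_eq_zero_of_nonneg_of_eq_zero hψ0 hψ1 ((one_le_div hs).2 hy)
  have hψ'le : ∀ t, deriv ψ t ≤ 0 := fun t ↦ hψa.deriv_nonpos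
  -- Green's identity: `∫ w Δu = −∫ ⟨dw, du⟩ = (1/s) ∫ (−ψ'(u/s)) |∇u|²`
  have hgreen := integral_mul_dalembertian_eq_neg_integral_innerDual_of_hasCompactSupport h hw1
    hwc hu2
  have hinner : ∀ y, g.innerDual y (mvfderiv I w y).toLinearMap (mvfderiv I u y).toLinearMap =
      deriv ψ (u y / s) / s * g.gradSq u y := by
    intro y
    have hd : mvfderiv I w y = (deriv ψ (u y / s) / s) • mvfderiv I u y := by
      have hζd : DifferentiableAt ℝ ζ (u y) := (hζs.differentiable one_ne_zero).differentiableAt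
      have hcomp : w = ζ ∘ u := rfl
      ext v
      rw [hcomp, mvfderiv_real_comp hζd ((hu1 y).mdifferentiableAt one_ne_zero) v, _root_.smul_apply,
        smul_eq_mul, hζ, deriv_comp_div_const hψd s (u y)]
    rw [hd, ContinuousLinearMap.toLinearMap_smul]
    simp only [innerDual, LinearMap.smul_apply, smul_eq_mul, gradSq]
  -- integrability
  have hwΔc : Continuous fun y ↦ w y * g.dalembertian u y :=
    hw1.continuous.mul (continuous_dalembertian _ hu2)
  have hwΔi : Integrable (fun y ↦ w y * g.dalembertian u y) μ :=
    integrable_of_continuous_of_hasCompactSupport h hwΔc hwc.mul_right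
  have hwi : Integrable w μ := integrable_of_continuous_of_hasCompactSupport h hw1.continuous hwc
  have hψ'c : Continuous fun y ↦ -deriv ψ (u y / s) :=
    ((hψ.continuous_deriv le_rfl).comp (huc.div_const s)).neg
  have hψ'supp : HasCompactSupport fun y ↦ -deriv ψ (u y / s) := by
    refine hcpt.of_isClosed_subset (isClosed_tsupport _) ?_
    refine closure_minimal (fun y hy ↦ ?_) (isClosed_le huc continuous_const)
    rw [mem_support] at hy
    by_contra h'
    simp only [mem_setOf_eq, not_le] at h'
    exact hy (by rw [hψ'0 y h'.le, neg_zero])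
  have hRc : Continuous fun y ↦ (-deriv ψ (u y / s)) * g.gradSq u y :=
    hψ'c.mul (continuous_innerDual_mvfderiv _ hu1 hu1)
  have hRi : Integrable (fun y ↦ (-deriv ψ (u y / s)) * g.gradSq u y) μ :=
    integrable_of_continuous_of_hasCompactSupport h hRc hψ'supp.mul_right
  have hR'c : Continuous fun y ↦ (-deriv ψ (u y / s)) * (u y / s) :=
    hψ'c.mul (huc.div_const s)
  have hR'i : Integrable (fun y ↦ (-deriv ψ (u y / s)) * (u y / s)) μ :=
    integrable_of_continuous_of_hasCompactSupport h hR'c hψ'supp.mul_right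
  -- left inequality: `c₁ ∫ w ≤ ∫ w Δu`
  have hleft : c₁ * ∫ y, w y ∂μ ≤ ∫ y, w y * g.dalembertian u y ∂μ := by
    rw [← integral_const_mul]
    refine integral_mono (hwi.const_mul c₁) hwΔi fun y ↦ ?_
    by_cases hy : u y < s
    · show c₁ * w y ≤ w y * g.dalembertian u y
      rw [mul_comm]
      exact mul_le_mul_of_nonneg_left (hΔ y hy) (hψ0 _)
    · show c₁ * w y ≤ w y * g.dalembertian u y
      rw [hw0 y (not_lt.1 hy), mul_zero, zero_mul]
  -- Green: `∫ w Δu = (1/s) ∫ (−ψ'(u/s)) |∇u|²`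
  have hmid : ∫ y, w y * g.dalembertian u y ∂μ =
      s⁻¹ * ∫ y, (-deriv ψ (u y / s)) * g.gradSq u y ∂μ := by
    rw [hgreen, integral_congr_ae (ae_of_all _ hinner), ← integral_neg, ← integral_const_mul]
    refine integral_congr_ae (ae_of_all _ fun y ↦ ?_)
    show -(deriv ψ (u y / s) / s * g.gradSq u y) = s⁻¹ * (-deriv ψ (u y / s) * g.gradSq u y)
    ring
  -- right inequality: `|∇u|² ≤ c₂ u` where `ψ'(u/s) ≠ 0`
  have hright : ∫ y, (-deriv ψ (u y / s)) * g.gradSq u y ∂μ ≤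
      ∫ y, (-deriv ψ (u y / s)) * (c₂ * u y) ∂μ := by
    have hi2 : Integrable (fun y ↦ (-deriv ψ (u y / s)) * (c₂ * u y)) μ := by
      have : (fun y ↦ (-deriv ψ (u y / s)) * (c₂ * u y)) =
          fun y ↦ (c₂ * s) * ((-deriv ψ (u y / s)) * (u y / s)) := by
        funext y
        field_simp
      rw [this]
      exact hR'i.const_mul _
    refine integral_mono hRi hi2 fun y ↦ ?_
    by_cases hy : u y < s
    · exact mul_le_mul_of_nonneg_left (hgrad y hy) (by linarith [hψ'le (u y / s)])
    · show -deriv ψ (u y / s) * g.gradSq u y ≤ -deriv ψ (u y / s) * (c₂ * u y)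
      rw [hψ'0 y (not_lt.1 hy), neg_zero, zero_mul, zero_mul]
  have hconv : ∫ y, (-deriv ψ (u y / s)) * (c₂ * u y) ∂μ =
      (c₂ * s) * ∫ y, (-deriv ψ (u y / s)) * (u y / s) ∂μ := by
    rw [← integral_const_mul]
    refine integral_congr_ae (ae_of_all _ fun y ↦ ?_)
    show -deriv ψ (u y / s) * (c₂ * u y) = c₂ * s * (-deriv ψ (u y / s) * (u y / s))
    field_simp
  -- assemble
  have hspos : 0 < s⁻¹ := inv_pos.2 hs
  calc c₁ * ∫ y, w y ∂μ ≤ ∫ y, w y * g.dalembertian u y ∂μ := hleft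
    _ = s⁻¹ * ∫ y, (-deriv ψ (u y / s)) * g.gradSq u y ∂μ := hmid
    _ ≤ s⁻¹ * ∫ y, (-deriv ψ (u y / s)) * (c₂ * u y) ∂μ :=
        mul_le_mul_of_nonneg_left hright hspos.le
    _ = c₂ * ∫ y, (-deriv ψ (u y / s)) * (u y / s) ∂μ := by
        rw [hconv]; field_simp

omit [I.Boundaryless] [(ofRiemannian h).HasLeviCivita] in
/-- **The smoothed volume ratio is differentiable**, with
`d/ds ∫ ψ(u/s) dμ = ∫ (−ψ'(u/s)) (u/s²) dμ`, for `0 < s < S` when the sublevel sets `{u ≤ t}`,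
`t < S`, are compact and `u ≥ 0` (differentiation under the integral sign, dominated on a
neighbourhood of `s` by a constant times the indicator of a compact sublevel set). [folklore] -/
theorem hasDerivAt_integral_comp_div {u : N → ℝ} (hu : CMDiff ∞ u) (hu0 : ∀ y, 0 ≤ u y)
    {S : ℝ} (hcpt : ∀ t < S, IsCompact {y | u y ≤ t})
    {ψ : ℝ → ℝ} (hψ : ContDiff ℝ 1 ψ) (hψ0 : ∀ t, 0 ≤ ψ t) (hψ1 : ∀ t, 1 ≤ t → ψ t = 0)
    {s : ℝ} (hs : 0 < s) (hsS : s < S) :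
    HasDerivAt (fun r ↦ ∫ y, ψ (u y / r) ∂riemannianMeasure h)
      (∫ y, (-deriv ψ (u y / s)) * (u y / s ^ 2) ∂riemannianMeasure h) s := by
  set μ := riemannianMeasure h with hμ
  have hψd : Differentiable ℝ ψ := hψ.differentiable one_ne_zero
  have huc : Continuous u := hu.continuous
  haveI : IsFiniteMeasureOnCompacts μ :=
    ⟨fun K hK ↦ riemannianVolume_lt_top_of_isCompact_holds h le_rfl hK⟩
  -- a neighbourhood `(a, b)` of `s` with `0 < a`, `b < S`
  set a : ℝ := s / 2 with ha
  set b : ℝ := (s + S) / 2 with hb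
  have ha0 : 0 < a := by positivity
  have has : a < s := by rw [ha]; linarith
  have hsb : s < b := by rw [hb]; linarith
  have hbS : b < S := by rw [hb]; linarith
  have hIoo : Ioo a b ∈ 𝓝 s := Ioo_mem_nhds has hsb
  -- the bound
  obtain ⟨B, hB0, hB⟩ := exists_bound_deriv_of_contDiff hψ hψ0 hψ1
  set K : Set N := {y | u y ≤ b} with hK
  have hKc : IsCompact K := hcpt b hbS
  have hKm : MeasurableSet K := (isClosed_le huc continuous_const).measurableSet
  set bound : N → ℝ := K.indicator fun _ ↦ B * (b / a ^ 2) with hbound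
  have hbound_int : Integrable bound μ :=
    (integrableOn_const (C := B * (b / a ^ 2)) hKc.measure_lt_top.ne).integrable_indicator hKm
  -- the integrand and its derivative
  set F : ℝ → N → ℝ := fun r y ↦ ψ (u y / r) with hF
  set F' : ℝ → N → ℝ := fun r y ↦ deriv ψ (u y / r) * (u y * (-(r ^ 2)⁻¹)) with hF'
  have hFc : ∀ r, Continuous (F r) := fun r ↦ hψ.continuous.comp (huc.div_const r)
  have hF'c : ∀ r, Continuous (F' r) := fun r ↦
    ((hψ.continuous_deriv le_rfl).comp (huc.div_const r)).mul (huc.mul continuous_const)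
  have hF_meas : ∀ᶠ r in 𝓝 s, AEStronglyMeasurable (F r) μ :=
    Eventually.of_forall fun r ↦ (hFc r).aestronglyMeasurable
  have hF_int : Integrable (F s) μ := by
    refine integrable_of_continuous_of_hasCompactSupport h (hFc s) ?_
    refine (hcpt s hsS).of_isClosed_subset (isClosed_tsupport _) ?_
    refine closure_minimal (fun y hy ↦ ?_) (isClosed_le huc continuous_const)
    rw [mem_support] at hy
    by_contra h'
    simp only [mem_setOf_eq, not_le] at h'
    exact hy (hψ1 _ ((one_le_div hs).2 h'.le))
  have hF'_meas : AEStronglyMeasurable (F' s) μ := (hF'c s).aestronglyMeasurable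
  have h_bound : ∀ᵐ y ∂μ, ∀ r ∈ Ioo a b, ‖F' r y‖ ≤ bound y := by
    refine ae_of_all _ fun y r hr ↦ ?_
    have hr0 : 0 < r := ha0.trans hr.1
    by_cases hyK : y ∈ K
    · rw [hbound, indicator_of_mem hyK, Real.norm_eq_abs, hF']
      dsimp only
      rw [abs_mul, abs_mul, abs_neg, abs_inv, abs_of_nonneg (hu0 y), abs_of_nonneg (sq_nonneg r)]
      have h1 : |deriv ψ (u y / r)| ≤ B := hB _ (div_nonneg (hu0 y) hr0.le)
      have h2 : u y * (r ^ 2)⁻¹ ≤ b / a ^ 2 := by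
        rw [← div_eq_mul_inv]
        have hyb : u y ≤ b := hyK
        have hra : a ^ 2 ≤ r ^ 2 := by nlinarith [hr.1, ha0]
        calc u y / r ^ 2 ≤ b / r ^ 2 := div_le_div_of_nonneg_right hyb (by positivity)
          _ ≤ b / a ^ 2 := div_le_div_of_nonneg_left (by linarith) (pow_pos ha0 2) hra
      calc |deriv ψ (u y / r)| * (u y * (r ^ 2)⁻¹) ≤ B * (b / a ^ 2) :=
            mul_le_mul h1 h2 (mul_nonneg (hu0 y) (inv_nonneg.2 (sq_nonneg r))) hB0
        _ = B * (b / a ^ 2) := rfl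
    · -- off `K`: `u y > b > r`, so `ψ' (u y / r) = 0`
      have hyb : b < u y := by
        by_contra h'; exact hyK (not_lt.1 h')
      have h1 : 1 ≤ u y / r := (one_le_div hr0).2 (by linarith [hr.2])
      rw [hbound, indicator_of_notMem hyK, hF']
      dsimp only
      rw [deriv_eq_zero_of_nonneg_of_eq_zero hψ0 hψ1 h1, zero_mul, norm_zero]
  have h_diff : ∀ᵐ y ∂μ, ∀ r ∈ Ioo a b, HasDerivAt (F · y) (F' r y) r := by
    refine ae_of_all _ fun y r hr ↦ ?_
    have hr0 : r ≠ 0 := (ha0.trans hr.1).ne'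
    exact hasDerivAt_comp_const_div hψd (u y) hr0
  have hmain := (hasDerivAt_integral_of_dominated_loc_of_deriv_le hIoo hF_meas hF_int hF'_meas
    h_bound hbound_int h_diff).2
  refine hmain.congr_deriv ?_
  refine integral_congr_ae (ae_of_all _ fun y ↦ ?_)
  show deriv ψ (u y / s) * (u y * (-(s ^ 2)⁻¹)) = -deriv ψ (u y / s) * (u y / s ^ 2)
  ring

/-- **The monotonicity formula, smoothed intrinsic form.** Let `(N, h)` be a Riemannian
manifold (boundaryless, not necessarily compact) and `u ∈ C^∞(N)`, `u ≥ 0`, with compact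
sublevel sets `{u ≤ t}` for `t < S` and

  `Δu ≥ c₁`  and  `|∇u|² ≤ c₂ u`  on `{u < S}`   (`c₂ > 0`).

Then for every nonnegative antitone `ψ ∈ C¹(ℝ)` vanishing on `[1, ∞)` the smoothed ratio
`s ↦ s^{−c₁/c₂} ∫_N ψ(u/s) dμ` is nondecreasing on `(0, S)`. (By
`mul_integral_comp_le_of_dalembertian_ge` and `hasDerivAt_integral_comp_div`,
`s I'(s) = ∫ (−ψ'(u/s))(u/s) ≥ (c₁/c₂) I(s)`, so `(I/s^γ)' ≥ 0`.) For a minimal `k`-dimensional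
submanifold `Σ ⊂ ℝⁿ` without boundary in `B_R(x₀)` and `u = |x − x₀|²/2` one has `Δ_Σ u = k`,
`|∇_Σ u|² ≤ 2u`, `γ = k/2`, and this is the monotonicity of `Vol(Σ ∩ B_r(x₀))/r^k`
(Allard 1972, 5.1 and Simon 1983, §17 for stationary surfaces; for area-minimising currents Federer
1969, 5.4.3 = Morgan 2016, Thm. 9.3). [cite: Morgan2016, Thm. 9.3 and Remark] [cite: Allard1972, §5.1] -/
theorem monotoneOn_rpow_mul_integral_comp_div {u : N → ℝ} (hu : CMDiff ∞ u) (hu0 : ∀ y, 0 ≤ u y)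
    {S : ℝ} (hcpt : ∀ t < S, IsCompact {y | u y ≤ t}) {c₁ c₂ : ℝ} (hc₂ : 0 < c₂)
    (hΔ : ∀ y, u y < S → c₁ ≤ (ofRiemannian h).dalembertian u y)
    (hgrad : ∀ y, u y < S → (ofRiemannian h).gradSq u y ≤ c₂ * u y)
    {ψ : ℝ → ℝ} (hψ : ContDiff ℝ 1 ψ) (hψ0 : ∀ t, 0 ≤ ψ t) (hψa : Antitone ψ)
    (hψ1 : ∀ t, 1 ≤ t → ψ t = 0) :
    MonotoneOn (fun s ↦ s ^ (-(c₁ / c₂)) * ∫ y, ψ (u y / s) ∂riemannianMeasure h) (Ioo 0 S) := by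
  set μ := riemannianMeasure h with hμ
  set γ : ℝ := c₁ / c₂ with hγ
  set Iψ : ℝ → ℝ := fun s ↦ ∫ y, ψ (u y / s) ∂μ with hI
  -- the derivative of `I` and the differential inequality `s I' ≥ γ I`
  have hderiv : ∀ s ∈ Ioo 0 S, HasDerivAt Iψ
      (∫ y, (-deriv ψ (u y / s)) * (u y / s ^ 2) ∂μ) s := fun s hs ↦
    hasDerivAt_integral_comp_div h hu hu0 hcpt hψ hψ0 hψ1 hs.1 hs.2
  have hineq : ∀ s ∈ Ioo 0 S, γ * Iψ s ≤
      s * ∫ y, (-deriv ψ (u y / s)) * (u y / s ^ 2) ∂μ := by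
    intro s hs
    have hs0 : 0 < s := hs.1
    have hcs : IsCompact {y | u y ≤ s} := hcpt s hs.2
    have h1 := mul_integral_comp_le_of_dalembertian_ge h hu hs0 hcs
      (fun y hy ↦ hΔ y (hy.trans hs.2)) (fun y hy ↦ hgrad y (hy.trans hs.2)) hψ hψ0 hψa hψ1
    have h2 : s * ∫ y, (-deriv ψ (u y / s)) * (u y / s ^ 2) ∂μ =
        ∫ y, (-deriv ψ (u y / s)) * (u y / s) ∂μ := by
      rw [← integral_const_mul]
      refine integral_congr_ae (ae_of_all _ fun y ↦ ?_)
      show s * (-deriv ψ (u y / s) * (u y / s ^ 2)) = -deriv ψ (u y / s) * (u y / s)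
      field_simp
    rw [h2, hγ, div_mul_eq_mul_div, div_le_iff₀ hc₂, mul_comm _ c₂]
    exact h1
  -- the derivative of `s ↦ s^{-γ} I(s)` is nonnegative
  set Φ : ℝ → ℝ := fun s ↦ s ^ (-γ) * Iψ s with hΦ
  have hΦd : ∀ s ∈ Ioo 0 S, HasDerivAt Φ
      ((-γ) * s ^ (-γ - 1) * Iψ s +
        s ^ (-γ) * ∫ y, (-deriv ψ (u y / s)) * (u y / s ^ 2) ∂μ) s := by
    intro s hs
    have hp : HasDerivAt (fun r : ℝ ↦ r ^ (-γ)) ((-γ) * s ^ (-γ - 1)) s :=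
      Real.hasDerivAt_rpow_const (Or.inl hs.1.ne')
    exact hp.mul (hderiv s hs)
  have hΦ' : ∀ s ∈ Ioo 0 S, 0 ≤ (-γ) * s ^ (-γ - 1) * Iψ s +
      s ^ (-γ) * ∫ y, (-deriv ψ (u y / s)) * (u y / s ^ 2) ∂μ := by
    intro s hs
    have hs0 : 0 < s := hs.1
    have hpow : s ^ (-γ - 1) = s ^ (-γ) * s⁻¹ := by
      rw [Real.rpow_sub hs0, Real.rpow_one, div_eq_mul_inv]
    have hkey := hineq s hs
    have hpos : 0 < s ^ (-γ) := Real.rpow_pos_of_pos hs0 _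
    -- `(-γ) s^{-γ-1} I + s^{-γ} I' = s^{-γ} s⁻¹ (s I' − γ I) ≥ 0`
    have : (-γ) * s ^ (-γ - 1) * Iψ s +
        s ^ (-γ) * ∫ y, (-deriv ψ (u y / s)) * (u y / s ^ 2) ∂μ =
        s ^ (-γ) * s⁻¹ * (s * (∫ y, (-deriv ψ (u y / s)) * (u y / s ^ 2) ∂μ) - γ * Iψ s) := by
      rw [hpow]
      field_simp
      ring
    rw [this]
    exact mul_nonneg (mul_nonneg hpos.le (inv_pos.2 hs0).le) (by linarith)
  -- conclude by the mean value theorem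
  have hconv : Convex ℝ (Ioo 0 S) := convex_Ioo 0 S
  have hint : interior (Ioo 0 S) = Ioo 0 S := interior_Ioo
  have hcont : ContinuousOn Φ (Ioo 0 S) := fun s hs ↦
    (hΦd s hs).continuousAt.continuousWithinAt
  have hdiff : DifferentiableOn ℝ Φ (interior (Ioo 0 S)) := by
    rw [hint]
    exact fun s hs ↦ (hΦd s hs).differentiableAt.differentiableWithinAt
  have hnonneg : ∀ s ∈ interior (Ioo 0 S), 0 ≤ deriv Φ s := by
    rw [hint]
    intro s hs
    rw [(hΦd s hs).deriv]
    exact hΦ' s hs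
  exact monotoneOn_of_deriv_nonneg hconv hcont hdiff hnonneg

/-! ### The sharp form: sublevel volumes -/

/-- The cutoffs `ψ_n(t) = smoothTransition((n+1)(1−t))`: smooth, with values in `[0,1]`, antitone,
`= 0` on `[1, ∞)` and `= 1` on `(−∞, 1 − 1/(n+1)]`. [folklore] -/
theorem stepCutoff_props (n : ℕ) :
    ContDiff ℝ 1 (fun t : ℝ ↦ Real.smoothTransition ((n + 1) * (1 - t))) ∧
    (∀ t, 0 ≤ Real.smoothTransition ((n + 1) * (1 - t))) ∧
    Antitone (fun t : ℝ ↦ Real.smoothTransition ((n + 1) * (1 - t))) ∧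
    (∀ t : ℝ, 1 ≤ t → Real.smoothTransition ((n + 1) * (1 - t)) = 0) ∧
    (∀ t : ℝ, (n + 1) * (1 - t) ≥ 1 → Real.smoothTransition ((n + 1) * (1 - t)) = 1) := by
  refine ⟨?_, fun t ↦ Real.smoothTransition.nonneg _, ?_, fun t ht ↦ ?_, fun t ht ↦ ?_⟩
  · exact Real.smoothTransition.contDiff.comp (contDiff_const.mul (contDiff_const.sub contDiff_id))
  · intro a b hab
    exact Real.smoothTransition.monotone (by nlinarith [hab, (n.cast_nonneg : (0:ℝ) ≤ n)])
  · exact Real.smoothTransition.zero_of_nonpos (by nlinarith [(n.cast_nonneg : (0:ℝ) ≤ n)])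
  · exact Real.smoothTransition.one_of_one_le ht

omit [I.Boundaryless] [(ofRiemannian h).HasLeviCivita] in
/-- The smoothed volumes `∫ ψ_n(u/s) dμ` tend to `μ{u < s}` (dominated convergence on the compact
`{u ≤ s}`). [folklore] -/
theorem tendsto_integral_stepCutoff {u : N → ℝ} (hu : Continuous u) {s : ℝ} (hs : 0 < s)
    (hcpt : IsCompact {y | u y ≤ s}) :
    Tendsto (fun n : ℕ ↦ ∫ y, Real.smoothTransition ((n + 1) * (1 - u y / s)) ∂riemannianMeasure h)
      atTop (𝓝 ((riemannianMeasure h).real {y | u y < s})) := by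
  set μ := riemannianMeasure h with hμ
  haveI : IsFiniteMeasureOnCompacts μ :=
    ⟨fun K hK ↦ riemannianVolume_lt_top_of_isCompact_holds h le_rfl hK⟩
  have hopen : IsOpen {y | u y < s} := isOpen_lt hu continuous_const
  have hKm : MeasurableSet {y | u y ≤ s} := (isClosed_le hu continuous_const).measurableSet
  rw [← integral_indicator_one hopen.measurableSet]
  refine tendsto_integral_of_dominated_convergence ({y | u y ≤ s}.indicator fun _ ↦ (1 : ℝ))
    (fun n ↦ ?_) ?_ (fun n ↦ ae_of_all _ fun y ↦ ?_) (ae_of_all _ fun y ↦ ?_)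
  · exact (Real.smoothTransition.continuous.comp
      (continuous_const.mul (continuous_const.sub (hu.div_const s)))).aestronglyMeasurable
  · exact (integrableOn_const (C := (1 : ℝ)) hcpt.measure_lt_top.ne).integrable_indicator hKm
  · -- domination by the indicator of `{u ≤ s}`
    rw [Real.norm_eq_abs, abs_of_nonneg (Real.smoothTransition.nonneg _)]
    by_cases hy : u y ≤ s
    · rw [indicator_of_mem (show y ∈ {y | u y ≤ s} from hy)]
      exact Real.smoothTransition.le_one _
    · rw [indicator_of_notMem (show y ∉ {y | u y ≤ s} from hy)]
      have h1 : 1 ≤ u y / s := (one_le_div hs).2 (le_of_not_ge hy)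
      rw [((stepCutoff_props n).2.2.2.1) _ h1]
  · -- pointwise convergence (eventually constant)
    by_cases hy : u y < s
    · rw [indicator_of_mem (show y ∈ {y | u y < s} from hy), Pi.one_apply]
      have hθ : 0 < 1 - u y / s := by
        rw [sub_pos, div_lt_one hs]; exact hy
      refine tendsto_const_nhds.congr' ?_
      obtain ⟨N₀, hN₀⟩ := exists_nat_gt (1 / (1 - u y / s))
      filter_upwards [Filter.eventually_ge_atTop N₀] with n hn
      symm
      apply (stepCutoff_props n).2.2.2.2
      have hn' : (N₀ : ℝ) ≤ n := by exact_mod_cast hn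
      have h1 : 1 < (N₀ : ℝ) * (1 - u y / s) := by
        rwa [div_lt_iff₀ hθ] at hN₀
      nlinarith
    · rw [indicator_of_notMem (show y ∉ {y | u y < s} from hy)]
      have h1 : 1 ≤ u y / s := (one_le_div hs).2 (le_of_not_gt hy)
      have : (fun n : ℕ ↦ Real.smoothTransition ((n + 1) * (1 - u y / s))) = fun _ ↦ 0 := by
        funext n
        exact (stepCutoff_props n).2.2.2.1 _ h1
      rw [this]
      exact tendsto_const_nhds

/-- **The monotonicity formula, intrinsic sharp form: `s ↦ μ{u < s}/s^{c₁/c₂}` is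
nondecreasing.** Under the hypotheses of `monotoneOn_rpow_mul_integral_comp_div` (`u ≥ 0`
smooth with compact sublevel sets below `S`, `Δu ≥ c₁`, `|∇u|² ≤ c₂ u` on `{u < S}`, `c₂ > 0`),
for `0 < s₁ ≤ s₂ < S`:

  `μ{u < s₁} / s₁^{c₁/c₂} ≤ μ{u < s₂} / s₂^{c₁/c₂}`

(let the cutoffs `ψ_n ↑ 1_{(−∞,1)}` in the smoothed form). For a `k`-dimensional minimal
submanifold `Σ` of `ℝⁿ`, proper in `B_R(x₀)` and without boundary there, `u = |x − x₀|²/2`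
restricted to `Σ` has `Δ_Σ u = k` and `|∇_Σ u|² ≤ 2u`, so with `s = r²/2` this is the classical
monotonicity `Vol(Σ ∩ B_r(x₀))/r^k ↑` (Morgan 2016, Thm. 9.3 with the Remark "Monotonicity for
minimal surfaces" — Allard 1972, 5.1 — and Cor. 9.5 `Area ≥ πr²`; Simon 1983, §17), in a form
that applies verbatim to minimal surfaces in a Riemannian manifold with a uniformly convex
exhaustion function (`Hess φ ≥ (1−ε) g`, `|∇φ|² ≤ 2(1+ε) φ`: exponent `(1−ε)/(1+ε) · k/2`), e.g. far
out on an asymptotically flat end (Schoen–Yau 1979, (2.4): `|y|²` is convex there).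
[cite: Morgan2016, Thm. 9.3, Remark and Cor. 9.5] [cite: Allard1972, §5.1] -/
theorem measureReal_setOf_lt_div_rpow_mono {u : N → ℝ} (hu : CMDiff ∞ u) (hu0 : ∀ y, 0 ≤ u y)
    {S : ℝ} (hcpt : ∀ t < S, IsCompact {y | u y ≤ t}) {c₁ c₂ : ℝ} (hc₂ : 0 < c₂)
    (hΔ : ∀ y, u y < S → c₁ ≤ (ofRiemannian h).dalembertian u y)
    (hgrad : ∀ y, u y < S → (ofRiemannian h).gradSq u y ≤ c₂ * u y)
    {s₁ s₂ : ℝ} (hs₁ : 0 < s₁) (h₁₂ : s₁ ≤ s₂) (hs₂ : s₂ < S) :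
    (riemannianMeasure h).real {y | u y < s₁} / s₁ ^ (c₁ / c₂) ≤
      (riemannianMeasure h).real {y | u y < s₂} / s₂ ^ (c₁ / c₂) := by
  set μ := riemannianMeasure h with hμ
  set γ : ℝ := c₁ / c₂ with hγ
  have hs₂0 : 0 < s₂ := hs₁.trans_le h₁₂
  -- the smoothed inequality for each cutoff `ψ_n`
  have hn : ∀ n : ℕ,
      s₁ ^ (-γ) * ∫ y, Real.smoothTransition ((n + 1) * (1 - u y / s₁)) ∂μ ≤
        s₂ ^ (-γ) * ∫ y, Real.smoothTransition ((n + 1) * (1 - u y / s₂)) ∂μ := by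
    intro n
    obtain ⟨hψ, hψ0, hψa, hψ1, -⟩ := stepCutoff_props n
    exact monotoneOn_rpow_mul_integral_comp_div h hu hu0 hcpt hc₂ hΔ hgrad hψ hψ0 hψa hψ1
      ⟨hs₁, h₁₂.trans_lt hs₂⟩ ⟨hs₂0, hs₂⟩ h₁₂
  -- pass to the limit
  have hl₁ := (tendsto_integral_stepCutoff h hu.continuous hs₁ (hcpt s₁ (h₁₂.trans_lt hs₂))).const_mul
    (s₁ ^ (-γ))
  have hl₂ := (tendsto_integral_stepCutoff h hu.continuous hs₂0 (hcpt s₂ hs₂)).const_mul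
    (s₂ ^ (-γ))
  have hlim := le_of_tendsto_of_tendsto' hl₁ hl₂ hn
  rw [Real.rpow_neg hs₁.le, Real.rpow_neg hs₂0.le] at hlim
  rw [div_eq_inv_mul, div_eq_inv_mul]
  exact hlim

end Core

end Literature.Geometry.Riemannian

end
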